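import Literature.MathematicalPhysics.QuantumLattice.GrassmannFlowStep
import Literature.MathematicalPhysics.QuantumLattice.GrassmannEffectiveActionTruncationDB
import Literature.MathematicalPhysics.QuantumLattice.GrassmannKernelExpansion
import HarnessLib

/-!
# One step of the flow of the top kernel under the replica-stable determinant bound: `‖λ' - λ‖ = O(‖V‖_h²)`

Topic `MathematicalPhysics/QuantumLattice`; the `IsGramBoundedR` twin of `GrassmannFlowStep.sum_norm_kernel_effAction_sub_le_of_top`
(Benfatto–Giuliani–Mastropietro 2006, (2.86)–(2.90); Gawȩdzki–Kupiainen 1985, §3: the running coupling of the TOP degree of a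
polynomial interaction does not move at first order — there are no higher kernels to self-contract — so after one single-scale
integration it has changed only at second order in `‖V‖_h`).  The Gram-form hypotheses `(q, f, g, κ)` of the original are replaced by
the determinant hypothesis `IsGramBoundedR C κ` of de Siqueira Pedra–Salmhofer (as in `GrassmannEffectiveActionTruncationDB`, whose
`sum_norm_kernel_effAction_sub_gaussConv_le_of_gramBounded` supplies the non-linear part; the linear part `e^{Δ_C}V - V` is
`GrassmannGaussConvKernelBound.sum_norm_kernel_gaussConv_sub_le`, whose Wick sum is empty in the top degree).  For an even `V`
without constant term whose even-degree pinned kernel norms are `N(m')` and vanish above degree `2p`, with `θ = eα‖V‖_h/κ² < 1`: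

`Σ_{W : W_i = w} ‖kernel (effAction C V - V) (2p) W‖ ≤ ρ^{-2p} · e‖V‖_h · θ/(1 - θ)`   (`sum_norm_kernel_effAction_sub_le_of_top_of_gramBounded`).

This is the form the scale-`0` VALUES clause of a quartic lattice vertex reads (the quartic kernel of `𝒱^{(0)} = effAction C V`
differs from the bare vertex by `O(U²)` in pinned `ℓ¹` norm, uniformly in the label set).

Everything is proved; no definition, no named fact.

## Sources

G. Benfatto, A. Giuliani, V. Mastropietro, Ann. Henri Poincaré 7 (2006) 809–898, (2.86)–(2.90) [`BenfattoGiulianiMastropietro2006`];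
K. Gawȩdzki, A. Kupiainen, Comm. Math. Phys. 102 (1985) 1–30, §3 [`GawedzkiKupiainen1985GrossNeveu`];
W. de Siqueira Pedra, M. Salmhofer, Comm. Math. Phys. 282 (2008) 797–818, Thm 1.3 [`PedraSalmhofer2008`].
-/

noncomputable section

namespace Literature.MathematicalPhysics.QuantumLattice

open GrassmannAlgebra Finset Literature.Probability.LatticeModels
open scoped Nat

universe u

variable {𝕜 : Type*} [RCLike 𝕜] {Γ : Type u} [Fintype Γ] [DecidableEq Γ] (C : Matrix Γ Γ 𝕜)

/-- **The top degree does not move at first order, determinant-bound form** (BGM 2006, (2.86)–(2.90); Gawȩdzki–Kupiainen 1985, §3: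
`λ' = λ + O(λ²)`): let `C` be replica-Gram-bounded with constant `κ > 0` and have row and column sums `≤ α`; let `V` be even, without
constant term, with pinned kernel norms `Σ_{Y : Y j = w} ‖kernel V (2m') Y‖ ≤ N(m')`, `N(m') = 0` for `m' > p`; let
`θ = eα‖V‖_h/κ² < 1` for a weight `ρ > 0`.  Then in the top degree `2p`, one output label pinned,
`Σ_{W : W_i = w} ‖kernel (effAction C V - V) (2p) W‖ ≤ ρ^{-2p} · e‖V‖_h · θ/(1 - θ)`.
[cite: BenfattoGiulianiMastropietro2006, (2.86)-(2.90)] -/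
theorem sum_norm_kernel_effAction_sub_le_of_top_of_gramBounded {κ : ℝ} (hκ : 0 < κ) (hGB : IsGramBoundedR C κ)
    (V : GrassmannAlgebra 𝕜 Γ) (hV : V ∈ evenPart 𝕜 Γ) (hV0 : constPart 𝕜 V = 0) (N : ℕ → ℝ) (hN0 : ∀ m', 0 ≤ N m')
    (hN : ∀ m' (j : Fin (2 * m')) (w : Γ),
      ∑ Y ∈ univ.filter (fun Y : Fin (2 * m') → Γ => Y j = w), ‖kernel 𝕜 V (2 * m') Y‖ ≤ N m')
    {α : ℝ} (hα : 0 < α) (hrow : ∀ X, ∑ Y, ‖C X Y‖ ≤ α) (hcol : ∀ Y, ∑ X, ‖C X Y‖ ≤ α) {ρ : ℝ} (hρ : 0 < ρ)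
    (hθ : Real.exp 1 * α * normV Γ κ ρ N / κ ^ 2 < 1)
    {p : ℕ} (hp : 0 < p) (htop : ∀ m', p < m' → N m' = 0) (i : Fin (2 * p)) (w : Γ) :
    ∑ W ∈ univ.filter (fun W : Fin (2 * p) → Γ => W i = w), ‖kernel 𝕜 (effAction 𝕜 C V - V) (2 * p) W‖ ≤
      ρ⁻¹ ^ (2 * p) * (Real.exp 1 * normV Γ κ ρ N) *
        (Real.exp 1 * α * normV Γ κ ρ N / κ ^ 2) / (1 - Real.exp 1 * α * normV Γ κ ρ N / κ ^ 2) := by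
  obtain ⟨k, hk⟩ := isNilpotent_grassmannLaplacian 𝕜 C
  -- a sup bound for `C`: every entry is at most a row sum
  have hs : ∀ A B, ‖C A B‖ ≤ α := fun A B =>
    (single_le_sum (f := fun Y => ‖C A Y‖) (fun Y _ => norm_nonneg _) (mem_univ B)).trans (hrow A)
  -- the pinned profile in ALL degrees: `N(m/2)` in the even degrees, `0` in the odd ones (`V` is even)
  set N' : ℕ → ℝ := fun m => if Even m then N (m / 2) else 0 with hN'def
  have hN' : ∀ (m : ℕ) (j : Fin m) (w' : Γ),
      ∑ Z ∈ univ.filter (fun Z : Fin m → Γ => Z j = w'), ‖kernel 𝕜 V m Z‖ ≤ N' m := by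
    -- transport `hN` along `m = 2 * (m / 2)` in the even degrees
    have key : ∀ (m₀ n : ℕ), n = 2 * m₀ → ∀ (j : Fin n) (w' : Γ),
        ∑ Z ∈ univ.filter (fun Z : Fin n → Γ => Z j = w'), ‖kernel 𝕜 V n Z‖ ≤ N m₀ := by
      intro m₀ n h j w'
      subst h
      exact hN m₀ j w'
    intro m j w'
    by_cases hm : Even m
    · rw [hN'def]
      simp only [if_pos hm]
      exact key (m / 2) m (Nat.two_mul_div_two_of_even hm).symm j w'
    · have hodd : Odd m := Nat.not_even_iff_odd.1 hm
      rw [hN'def]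
      simp only [if_neg hm]
      refine (sum_eq_zero fun Z _ => ?_).le
      rw [kernel_eq_zero_of_mem_evenPart_of_odd 𝕜 hV hodd Z, norm_zero]
  -- the linear part: the Wick self-contraction sum is empty in the top degree
  have h2 := sum_norm_kernel_gaussConv_sub_le C hk hs V N' hN' (2 * p) i w
  have hzero : ∑ j ∈ Ico 1 k, ((2 * p + 2 * j)! : ℝ) / (((2 * p)! : ℝ) * (j ! : ℝ) * 2 ^ j) * α ^ j * N' (2 * p + 2 * j) = 0 := by
    refine sum_eq_zero fun j hj => ?_
    have hj1 : 1 ≤ j := (mem_Ico.1 hj).1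
    have hE : Even (2 * p + 2 * j) := ⟨p + j, by ring⟩
    have hval : N' (2 * p + 2 * j) = 0 := by
      rw [hN'def]
      simp only [if_pos hE]
      rw [show (2 * p + 2 * j) / 2 = p + j by omega]
      exact htop (p + j) (by omega)
    rw [hval, mul_zero]
  rw [hzero] at h2
  -- the non-linear part
  obtain ⟨-, h3⟩ := sum_norm_kernel_effAction_sub_gaussConv_le_of_gramBounded C hκ hGB V hV hV0 N hN0 hN hα hrow hcol hρ hθ
  have h3' := h3 (by omega : 0 < 2 * p) i w
  have hsplit : ∀ W, kernel 𝕜 (effAction 𝕜 C V - V) (2 * p) W = kernel 𝕜 (gaussConv 𝕜 C V - V) (2 * p) W +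
      kernel 𝕜 (effAction 𝕜 C V - gaussConv 𝕜 C V) (2 * p) W := by
    intro W
    rw [← kernel_add]
    congr 1
    abel
  calc ∑ W ∈ univ.filter (fun W : Fin (2 * p) → Γ => W i = w), ‖kernel 𝕜 (effAction 𝕜 C V - V) (2 * p) W‖
      ≤ ∑ W ∈ univ.filter (fun W : Fin (2 * p) → Γ => W i = w), (‖kernel 𝕜 (gaussConv 𝕜 C V - V) (2 * p) W‖ +
          ‖kernel 𝕜 (effAction 𝕜 C V - gaussConv 𝕜 C V) (2 * p) W‖) :=
        sum_le_sum fun W _ => by rw [hsplit W]; exact norm_add_le _ _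
    _ = _ := by rw [sum_add_distrib]
    _ ≤ 0 + _ := add_le_add h2 h3'
    _ = _ := zero_add _

/-- **Quartic case**: for an even `V` without constant term whose kernels live in degrees `2` and `4` only (`N(m') = 0` for
`m' > 2`: a quartic vertex plus a quadratic counterterm), the quartic kernel of `effAction C V` differs from that of `V` by
`≤ ρ^{-4} · e‖V‖_h · θ/(1 - θ)` in every pinned `ℓ¹` norm. [cite: BenfattoGiulianiMastropietro2006, (2.86)-(2.90)] -/
theorem sum_norm_kernel_four_effAction_sub_le_of_gramBounded {κ : ℝ} (hκ : 0 < κ) (hGB : IsGramBoundedR C κ)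
    (V : GrassmannAlgebra 𝕜 Γ) (hV : V ∈ evenPart 𝕜 Γ) (hV0 : constPart 𝕜 V = 0) (N : ℕ → ℝ) (hN0 : ∀ m', 0 ≤ N m')
    (hN : ∀ m' (j : Fin (2 * m')) (w : Γ),
      ∑ Y ∈ univ.filter (fun Y : Fin (2 * m') → Γ => Y j = w), ‖kernel 𝕜 V (2 * m') Y‖ ≤ N m')
    {α : ℝ} (hα : 0 < α) (hrow : ∀ X, ∑ Y, ‖C X Y‖ ≤ α) (hcol : ∀ Y, ∑ X, ‖C X Y‖ ≤ α) {ρ : ℝ} (hρ : 0 < ρ)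
    (hθ : Real.exp 1 * α * normV Γ κ ρ N / κ ^ 2 < 1)
    (htop : ∀ m', 2 < m' → N m' = 0) (i : Fin 4) (w : Γ) :
    ∑ W ∈ univ.filter (fun W : Fin 4 → Γ => W i = w), ‖kernel 𝕜 (effAction 𝕜 C V - V) 4 W‖ ≤
      ρ⁻¹ ^ 4 * (Real.exp 1 * normV Γ κ ρ N) *
        (Real.exp 1 * α * normV Γ κ ρ N / κ ^ 2) / (1 - Real.exp 1 * α * normV Γ κ ρ N / κ ^ 2) :=
  sum_norm_kernel_effAction_sub_le_of_top_of_gramBounded C hκ hGB V hV hV0 N hN0 hN hα hrow hcol hρ hθ (p := 2) two_pos htop i w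

end Literature.MathematicalPhysics.QuantumLattice

end
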